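import Summits.AtomisticToContinuum.HydrodynamicLimit.Theorems.InformationPercolationEnginePercolationClosesChaosForecastTransferArchW
import Summits.AtomisticToContinuum.HydrodynamicLimit.Theorems.InformationPercolationEnginePercolationClosesChaosForecastRobustReveal
import Summits.AtomisticToContinuum.HydrodynamicLimit.Theorems.InformationPercolationEnginePercolationClosesChaosForecastSplitW
import Summits.AtomisticToContinuum.HydrodynamicLimit.Theorems.InformationPercolationEnginePercolationClosesChaosForecastNonGoodRareW
import Summits.AtomisticToContinuum.HydrodynamicLimit.Theorems.InformationPercolationEnginePercolationClosesChaosForecastBadForecastRareB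
import Summits.AtomisticToContinuum.HydrodynamicLimit.Theorems.InformationPercolationEnginePercolationClosesChaosForecastSwap
import Summits.AtomisticToContinuum.HydrodynamicLimit.Theorems.InformationPercolationEnginePercolationClosesChaosRevealedSandwich
import Summits.AtomisticToContinuum.HydrodynamicLimit.Theorems.InformationPercolationEnginePercolationClosesChaosForecastAlgebra
import HarnessLib

/-!
# Forecast transfer S6 of the line `equilibrium-forecast-chain-rule` (crux `InformationPercolationEngine.PercolationClosesChaos`,
stmt-AtomisticToContinuum-15178) — the registered stub `stub_forecastTransferW` of skeleton v9 (lead c4, line cycle 5), CLOSED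

Support file (`--supports stmt-AtomisticToContinuum-15178`): the WEIGHTED forecast transfer of skeleton v9,

  `stub_forecastTransferW : MesoForecastChaosB → LocalCountUI → NoKineticIrregularityB → CoarseLocalMaxwellianityW →
     RevealedDefectStability → KineticCellChaosLG`,

obtained from the weighted architecture `kineticCellChaosLG_of_w : ForecastSwap → BadForecastRareB → NonGoodRareW → RevealedSandwich →
ForecastAlgebra → ForecastSplitW → KineticCellChaosLG` (`…ForecastTransferArchW`, p154660, lead c4) with its six hypotheses discharged:

* H1 `forecastSwap_holds` (`…ForecastSwap`, p141614 — the predictable projection APPLIED under `LG` against `G_N`),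
* H2_B `badForecastRareB_of : MesoForecastChaosB → BadForecastRareB` (`…ForecastBadForecastRareB`, p155066, wave-1 worker W5 of cycle 5),
* H3_W `nonGoodRareW_of : JngSpec → CoarseLocalMaxwellianityW → LocalCountUI → NoKineticIrregularityB → NonGoodRareW` (`…ForecastNonGoodRareW`,
  p156204, worker W3) with the dictionary fact `jngSpec_holds : JngSpec` (`…ForecastRobustReveal`, p155264, worker W1),
* H4 `revealedSandwich_of : RevealedDefectStability → RevealedSandwich` (`…RevealedSandwich`, p144080),
* H5 `forecastAlgebra_holds` (`…ForecastAlgebra`, p144106),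
* H5_W `forecastSplitW_of : JngSpec → ForecastSplitW` (`…ForecastSplitW`, p155577, worker W2 — the weighted per-unit split through the REVEALED
  non-good indicator `Jng`, pulled inside the `G_N`-conditional expectation).

Compared with the v5 transfer `stub_forecastTransfer` (p147963) the first antecedent now carries the BINNED good-unit guard (`MesoForecastChaosB`), the
third reads the inhomogeneity on binned velocities (`NoKineticIrregularityB`), and the fourth is the COLLISION-WEIGHTED local Maxwellianity
(`CoarseLocalMaxwellianityW`) — fed in the skeleton by `stub_cesaroW` (p155628) from the weighted, robust `MesoStaticMaxwellRarityW` instead of the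
log-marginal `MesoStaticMaxwellRarity` (lead report c4).
-/

noncomputable section

open MeasureTheory Set Filter Topology
open scoped ENNReal BigOperators Classical
open Literature.Analysis.FluidPDE Literature.MathematicalPhysics.KineticTheory
open Literature.MathematicalPhysics.KineticTheory.VelocityBlindPlacement

namespace Summit.AtomisticToContinuum.HydrodynamicLimit.Theorems.EquilibriumForecastLine

/-- **Registered stub S6 of skeleton v9 `stub_forecastTransferW` (lead c4): the WEIGHTED forecast transfer.** Forecast chaos of binned-good units under
the invariant law (`MesoForecastChaosB`, crux-class), local uniform integrability / packing (`LocalCountUI`), no kinetic irregularity on binned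
velocities (`NoKineticIrregularityB`), collision-weighted local equilibrium at the kinetic-cell scale (`CoarseLocalMaxwellianityW`) and
revealed-defect stability (`RevealedDefectStability`) under the EVOLVED law imply kinetic-cell chaos under the evolved law (`KineticCellChaosLG`).
Proof: the weighted architecture `kineticCellChaosLG_of_w` with H1, H2_B, H3_W, H4, H5, H5_W discharged (module docstring). [folklore] -/
theorem stub_forecastTransferW : MesoForecastChaosB → LocalCountUI → NoKineticIrregularityB → CoarseLocalMaxwellianityW → RevealedDefectStability → KineticCellChaosLG :=
  fun h2 h3 h4b h5 h8 =>
    kineticCellChaosLG_of_w forecastSwap_holds (badForecastRareB_of h2) (nonGoodRareW_of jngSpec_holds h5 h3 h4b)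
      (revealedSandwich_of h8) forecastAlgebra_holds (forecastSplitW_of jngSpec_holds)

end Summit.AtomisticToContinuum.HydrodynamicLimit.Theorems.EquilibriumForecastLine

end
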